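import Summits.HubbardSuperconductivity.HubbardSuperconductivity.Theorems.BirComplexStableXY.Negative.WitnessTable
import Literature.MathematicalPhysics.QuantumFieldTheory.TorusChartCochains
import HarnessLib

/-!
# Crux `BirComplexStableXYR`, line `fat-gaussian-defect-calculus`: stub P1a `stub_pathCfg_d0`

Registered stub (lead c7, skeleton `Cruxes/BirComplexStableXYR/Lines/fat_gaussian_defect_calculus.lean`), helper
(`--supports`) for the crux `Summit.HubbardSuperconductivity.HubbardSuperconductivity.Theses.BalabanIR.BirComplexStableXYR`:
**the window path identity at the level of configurations.**  On the engine's torus `Λ L M = (Fin 2 → ZMod L) × ZMod M`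
with the space–time chart `TorusChart.piProdZMod 2 L M` (directions `0, 1` spatial, `2` temporal), the staircase sum
inside the window with corner `s` — `w.1` edges in direction `0`, then `w.2.1` edges in direction `1`, then `w.2.2`
edges in direction `2` — of the shifted gradient `d₀φ − 2πa` (`a` an integer `1`-cochain) equals
`φ (sh L M s w) − φ s − 2π · (staircase sum of a)`.

Proof: on any charted torus, one line sum of `d₀φ − 2πa` is `φ(end) − φ(start) − 2π · (line sum of a)`
(`lineSum_sub`, the telescoping `lineSum_d₀`, and `Finset.mul_sum` / `Int.cast_sum`); the three lines telescope, and
the endpoint `s + w.1 • e₀ + w.2.1 • e₁ + w.2.2 • e₂` of the staircase is `sh L M s w` because the unit translations of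
`piProdZMod 2 L M` are `e₀ = (Pi.single 0 1, 0)`, `e₁ = (Pi.single 1 1, 0)`, `e₂ = (0, 1)`.  No definitions;
sorry-free.
-/

set_option linter.dupNamespace false -- summit = problem name (single-conjunct summit), D-0017

namespace Summit.HubbardSuperconductivity.HubbardSuperconductivity.Theorems.FSUnfolding

open scoped BigOperators
open Literature.MathematicalPhysics.QuantumFieldTheory Literature.Probability.LatticeModels
open Summit.HubbardSuperconductivity.BirComplexStableXYNegative

/-- **One line of the path identity** (any charted torus).  The line sum of the shifted gradient `d₀φ − 2πa` along
`n` edges in direction `i` from `y` is `φ (y + n • e_i) − φ y − 2π · (line sum of a)`. [folklore] -/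
theorem lineSum_d₀_sub_two_pi_mul {Λ : Type*} [AddCommGroup Λ] {d : ℕ} (F : TorusChart Λ d)
    (φ : Λ → ℝ) (a : Λ → Fin d → ℤ) (i : Fin d) (n : ℕ) (y : Λ) :
    F.lineSum (fun x j => F.d₀ φ x j - 2 * Real.pi * (a x j : ℝ)) i n y
      = φ (y + n • F.gen i) - φ y - 2 * Real.pi * ((F.lineSum a i n y : ℤ) : ℝ) := by
  have h1 : (fun x j => F.d₀ φ x j - 2 * Real.pi * (a x j : ℝ))
      = F.d₀ φ - (fun x j => 2 * Real.pi * (a x j : ℝ)) := rfl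
  rw [h1, F.lineSum_sub, F.lineSum_d₀]
  simp only [TorusChart.lineSum, Int.cast_sum, Finset.mul_sum]

/-- **The staircase endpoint.**  In the space–time chart `piProdZMod 2 L M` of `Λ L M = (Fin 2 → ZMod L) × ZMod M`,
walking `w.1` unit steps in direction `0`, `w.2.1` in direction `1` and `w.2.2` in direction `2` from `s` lands at the
window-shifted site `sh L M s w = (s.1 + ![w.1, w.2.1], s.2 + w.2.2)`. [folklore] -/
theorem staircase_endpoint_eq_sh (r L M : ℕ) [NeZero L] [NeZero M] (s : Λ L M) (w : W r) :
    s + (w.1 : ℕ) • (TorusChart.piProdZMod 2 L M).gen 0 + (w.2.1 : ℕ) • (TorusChart.piProdZMod 2 L M).gen 1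
        + (w.2.2 : ℕ) • (TorusChart.piProdZMod 2 L M).gen 2
      = sh L M s w := by
  have h0 : (TorusChart.piProdZMod 2 L M).gen 0 = (Pi.single 0 1, 0) :=
    TorusChart.piProdZMod_gen_castSucc 2 L M 0
  have h1 : (TorusChart.piProdZMod 2 L M).gen 1 = (Pi.single 1 1, 0) :=
    TorusChart.piProdZMod_gen_castSucc 2 L M 1
  have h2 : (TorusChart.piProdZMod 2 L M).gen 2 = (0, 1) :=
    TorusChart.piProdZMod_gen_last 2 L M
  rw [h0, h1, h2]
  refine Prod.ext ?_ ?_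
  · funext j
    simp only [sh, Prod.fst_add, Pi.add_apply, nsmul_eq_mul]
    fin_cases j <;> simp
  · simp [sh]

/-- **Stub P1a `stub_pathCfg_d0` (registered signature, verbatim): the window path identity at the level of
configurations.**  On the engine's torus `Λ L M = (Fin 2 → ZMod L) × ZMod M` (chart `TorusChart.piProdZMod 2 L M`:
directions `0,1` spatial, `2` temporal) the staircase sum inside the window with corner `s` — `w.1` edges in
direction `0`, then `w.2.1` in direction `1`, then `w.2.2` in direction `2` — of the shifted gradient `d₀φ − 2πa`
equals `φ(sh L M s w) − φ(s)` minus `2π` times the (integer) staircase sum of `a`.  (`lineSum_sub`, `lineSum_d₀`;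
the endpoint `s + w.1•e₀ + w.2.1•e₁ + w.2.2•e₂ = sh L M s w`.) [folklore] -/
theorem stub_pathCfg_d0 :
    ∀ (r L M : ℕ) [NeZero L] [NeZero M] (φ : Λ L M → ℝ) (a : Λ L M → Fin 3 → ℤ) (s : Λ L M) (w : W r),
      (TorusChart.piProdZMod 2 L M).lineSum
          (fun x i => (TorusChart.piProdZMod 2 L M).d₀ φ x i - 2 * Real.pi * (a x i : ℝ)) 0 (w.1 : ℕ) s
        + (TorusChart.piProdZMod 2 L M).lineSum
          (fun x i => (TorusChart.piProdZMod 2 L M).d₀ φ x i - 2 * Real.pi * (a x i : ℝ)) 1 (w.2.1 : ℕ)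
            (s + (w.1 : ℕ) • (TorusChart.piProdZMod 2 L M).gen 0)
        + (TorusChart.piProdZMod 2 L M).lineSum
          (fun x i => (TorusChart.piProdZMod 2 L M).d₀ φ x i - 2 * Real.pi * (a x i : ℝ)) 2 (w.2.2 : ℕ)
            (s + (w.1 : ℕ) • (TorusChart.piProdZMod 2 L M).gen 0 + (w.2.1 : ℕ) • (TorusChart.piProdZMod 2 L M).gen 1)
      = φ (sh L M s w) - φ s - 2 * Real.pi *
          (((TorusChart.piProdZMod 2 L M).lineSum a 0 (w.1 : ℕ) s
            + (TorusChart.piProdZMod 2 L M).lineSum a 1 (w.2.1 : ℕ) (s + (w.1 : ℕ) • (TorusChart.piProdZMod 2 L M).gen 0)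
            + (TorusChart.piProdZMod 2 L M).lineSum a 2 (w.2.2 : ℕ)
              (s + (w.1 : ℕ) • (TorusChart.piProdZMod 2 L M).gen 0
                + (w.2.1 : ℕ) • (TorusChart.piProdZMod 2 L M).gen 1) : ℤ) : ℝ) := by
  intro r L M _ _ φ a s w
  rw [lineSum_d₀_sub_two_pi_mul, lineSum_d₀_sub_two_pi_mul, lineSum_d₀_sub_two_pi_mul,
    staircase_endpoint_eq_sh r L M s w]
  push_cast
  ring

end Summit.HubbardSuperconductivity.HubbardSuperconductivity.Theorems.FSUnfolding
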